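/-
Copyright (c) 2026 the pub-hodgecm-mathlib formalisation cell (harness21).  Prover seat hodgecm-mathlib-K2E3-p04 (g0), Track B ∕ K2-LIT
(build stream 29), h413 = `stmt-HodgeConjecture-24833`, line `K2_E3_EllipticInputs`, unit U4 «Keys» — DEAL `K2E3RankOneIntertwiningIntegral`, RUNG 3 (convergence),
generic base layer «HEIGHT-SHELL SUMMABILITY».  2026-09-03.
-/
import Mathlib.MeasureTheory.Integral.IntegrableOn
import Mathlib.MeasureTheory.Function.SpecialFunctions.Basic
import Mathlib.Analysis.SpecialFunctions.Pow.Real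
import Mathlib.Analysis.SpecificLimits.Basic
import HarnessLib

/-!
# h413 ∕ Track B «K2-LIT», unit U4 «Keys», DEAL `K2E3RankOneIntertwiningIntegral` — RUNG 3 base layer «HEIGHT-SHELL SUMMABILITY» (generic, Mathlib-only):
# `∫_{A < m} m^{-p} dμ < ∞` when a measure-scaling map expands the height `m` by `Q > 1`, scales `μ` by `κ`, and `κ · Q^p > 1`

Cell `pub/hodgecm-mathlib`, crux H413 = `stmt-HodgeConjecture-24833` (lane `--supports … --as helper`), route HCCMUnconditional; dealer K2E3-plan (g1) (DEALS BATCH #1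
2026-09-03T22:03Z, «p04 DEAL `K2E3RankOneIntertwiningIntegral` … absolute convergence for `χ₁ = η‖·‖_E^s`, `Re s > s₀`»).  THEOREMS ONLY (0 def ∕ 0 instance ∕ 0 notation ∕
0 sorry); imports Mathlib + HarnessLib only.  Nothing here is specific to `U(3)`: it is the measure-theoretic skeleton of «integrate the Iwasawa height shell by shell»
([Casselman1995, §6.4 p. 63: the convergence of `T_w` «reduces to a geometric series»]; [TateThesis1967, §2.4]; [WeilBNT1967, II §5 Prop. 12]), in the style of ★
`F0P3cStCharTSHeightShellFundamentalDomain` (which treats INVARIANT integrands; here the integrand DECAYS).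

WHAT.  `(Γ, μ)` a measure space, `m : Γ → ℝ` a measurable HEIGHT, `c : Γ → Γ` measurable with `μ.map c = κ • μ` (`κ ∈ ℝ≥0`, `κ ≠ 0`) EXPANDING the height:
`m (c γ) = Q · m γ`, `Q > 1` (think: `Γ = N(L⁺_v)`, `m(u) = ‖u₀₂‖`, `c = Ad(t⁻¹)` for a torus element with `‖t₀₀‖ < 1`, `Q = ‖t₀₀‖⁻²`, `κ = δ_B(t) = ‖t₀₀‖²`).
* §1 `coe_pow_mul_measure_ball_eq` — the balls `B_T = {m ≤ T}` scale: `κ^k · μ(B_{A Q^k}) = μ(B_A)` (`c⁻¹(B_{AQ^{k+1}}) = B_{AQ^k}`); `measure_ball_pow_eq` — `μ(B_{AQ^k}) = κ⁻ᵏ μ(B_A)`.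
* §2 `rpow_neg_le_on_shell` — on the shell `A Q^k ≤ m` the integrand `m^{-p}` (`p > 0`) is at most `A^{-p} (Q^{-p})^k`; `setOf_lt_subset_iUnion_shell` — `{A < m} ⊆ ⋃_k {AQ^k ≤ m ≤ AQ^{k+1}}`
  (Mathlib `exists_nat_pow_near`).
* §3 **`lintegral_rpow_neg_lt_top_of_scaling`** — if `μ(B_A) < ∞` (`A > 0`) and `κ · Q^p > 1` then `∫⁻_{A < m} m^{-p} dμ ≤ μ(B_A) κ⁻¹ A^{-p} · Σ_k (Q^{-p} κ⁻¹)^k < ∞`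
  (geometric series of ratio `(κ Q^p)⁻¹ < 1`, Mathlib `ENNReal.tsum_geometric`); **`integrableOn_rpow_neg_of_scaling`** — the `IntegrableOn` form for the real integrand.
CONSUMER: `K2E3RankOneIntertwiningIntegralConvergence` (the `hint₀` of ★ `K2E3RankOneIntertwiningIntegral.exists_intertwiningIntegral_cmPrincipalSeries`: the cell function of a
section of `i_G(χ₁, χ₂)` is `O(‖u₀₂‖^{-(Re s + 1)})` far out, ★ `F0P3cStCharTSCellFunFarOut`, and `κ Q^p = ‖t₀₀‖^{2 − 2(Re s + 1)} > 1` iff `Re s > 0`).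

HONEST LABEL.  HC_CM is proved only modulo the 7 printed citations (2 remaining named inputs: hLiu418 = `stmt-HodgeConjecture-24832`, h413 = `stmt-HodgeConjecture-24833`) until
rung 0 closes; count-neutral generic measure theory.

## References
* [Casselman1995] W. Casselman, *Introduction to the theory of admissible representations of `p`-adic reductive groups* (1995), §6.4 pp. 62–64 (convergence of `T_w`).
* [TateThesis1967] J. Tate, *Fourier analysis in number fields and Hecke's zeta-functions*, in Cassels–Fröhlich (1967), §2.4 (integration over `k^×` shell by shell).
* [WeilBNT1967] A. Weil, *Basic Number Theory* (1967), Ch. II §5 Prop. 12.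
-/

set_option autoImplicit false
-- the mandated namespace repeats the single-problem summit's segment (`HodgeConjecture.HodgeConjecture`)
set_option linter.dupNamespace false

noncomputable section

open MeasureTheory
open scoped NNReal ENNReal

namespace Summit.HodgeConjecture.HodgeConjecture.Cruxes.H413.K2E3IntertwiningIntegralShellBound

variable {Γ : Type*} [MeasurableSpace Γ] (μ : Measure Γ) {m : Γ → ℝ} (hm : Measurable m) {c : Γ → Γ} (hc : Measurable c)
  {κ : ℝ≥0} (hκ : μ.map c = κ • μ) {Q : ℝ} (hQ : 0 < Q) (hmc : ∀ γ, m (c γ) = Q * m γ)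

/-! ## §1 The balls `B_T = {m ≤ T}` scale under `c` -/

include hQ hmc in
omit [MeasurableSpace Γ] in
/-- `c⁻¹(B_{T·Q}) = B_T`: `m (c γ) = Q m γ ≤ T Q ↔ m γ ≤ T`. [cite: WeilBNT1967, Ch. II §5 Prop. 12] -/
theorem preimage_ball_mul (T : ℝ) : c ⁻¹' {γ | m γ ≤ T * Q} = {γ | m γ ≤ T} := by
  ext γ
  simp only [Set.mem_preimage, Set.mem_setOf_eq, hmc, mul_comm Q]
  exact mul_le_mul_iff_of_pos_right hQ

include hm hc hκ hQ hmc in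
/-- **`κ · μ(B_{TQ}) = μ(B_T)`** (`μ.map c = κ • μ` evaluated on `B_{TQ}`, whose preimage is `B_T`). [cite: WeilBNT1967, Ch. II §5 Prop. 12] -/
theorem coe_mul_measure_ball_mul (T : ℝ) : (κ : ℝ≥0∞) * μ {γ | m γ ≤ T * Q} = μ {γ | m γ ≤ T} := by
  have hmeas : MeasurableSet {γ | m γ ≤ T * Q} := measurableSet_le hm measurable_const
  have h := congrArg (fun ν : Measure Γ => ν {γ | m γ ≤ T * Q}) hκ
  simp only [Measure.map_apply hc hmeas, preimage_ball_mul hQ hmc, Measure.coe_nnreal_smul_apply] at h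
  exact h.symm

include hm hc hκ hQ hmc in
/-- **`κ^k · μ(B_{A Q^k}) = μ(B_A)`** (induction on `k`). [cite: WeilBNT1967, Ch. II §5 Prop. 12] -/
theorem coe_pow_mul_measure_ball_eq (A : ℝ) (k : ℕ) : (κ : ℝ≥0∞) ^ k * μ {γ | m γ ≤ A * Q ^ k} = μ {γ | m γ ≤ A} := by
  induction k with
  | zero => rw [pow_zero, pow_zero, one_mul, mul_one]
  | succ k ih =>
    rw [pow_succ (κ : ℝ≥0∞), show A * Q ^ (k + 1) = A * Q ^ k * Q by rw [pow_succ, mul_assoc], mul_assoc,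
      coe_mul_measure_ball_mul μ hm hc hκ hQ hmc (A * Q ^ k), ih]

include hm hc hκ hQ hmc in
/-- **`μ(B_{A Q^k}) = κ⁻ᵏ · μ(B_A)`** for `κ ≠ 0`. [cite: WeilBNT1967, Ch. II §5 Prop. 12] -/
theorem measure_ball_pow_eq (hκ0 : κ ≠ 0) (A : ℝ) (k : ℕ) : μ {γ | m γ ≤ A * Q ^ k} = ((κ : ℝ≥0∞)⁻¹) ^ k * μ {γ | m γ ≤ A} := by
  rw [← coe_pow_mul_measure_ball_eq μ hm hc hκ hQ hmc A k, ← mul_assoc, ← mul_pow,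
    ENNReal.inv_mul_cancel (ENNReal.coe_ne_zero.2 hκ0) ENNReal.coe_ne_top, one_pow, one_mul]

/-! ## §2 The shells `A Q^k ≤ m ≤ A Q^{k+1}` cover `{A < m}`; the integrand on a shell -/

omit [MeasurableSpace Γ] in
/-- `{A < m} ⊆ ⋃_k {A Q^k ≤ m ≤ A Q^{k+1}}` for `A > 0`, `Q > 1` (Mathlib `exists_nat_pow_near` on `m γ ∕ A ≥ 1`). [cite: TateThesis1967, §2.4] -/
theorem setOf_lt_subset_iUnion_shell {A : ℝ} (hA : 0 < A) (hQ1 : 1 < Q) :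
    {γ | A < m γ} ⊆ ⋃ k : ℕ, {γ | A * Q ^ k ≤ m γ ∧ m γ ≤ A * Q ^ (k + 1)} := by
  intro γ hγ
  simp only [Set.mem_setOf_eq] at hγ
  obtain ⟨k, hk1, hk2⟩ := exists_nat_pow_near ((one_le_div hA).2 hγ.le) hQ1
  refine Set.mem_iUnion.2 ⟨k, ?_, ?_⟩
  · show A * Q ^ k ≤ m γ
    rw [mul_comm]
    exact (le_div_iff₀ hA).1 hk1
  · show m γ ≤ A * Q ^ (k + 1)
    rw [mul_comm]
    exact ((div_lt_iff₀ hA).1 hk2).le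

omit [MeasurableSpace Γ] in
include hQ in
/-- On the shell `A Q^k ≤ m γ` (`A > 0`, `p > 0`): `(m γ)^{-p} ≤ A^{-p} · (Q^{-p})^k`. [cite: Casselman1995, §6.4 p. 63] -/
theorem rpow_neg_le_on_shell {A : ℝ} (hA : 0 < A) {p : ℝ} (hp : 0 < p) (k : ℕ) {γ : Γ} (hγ : A * Q ^ k ≤ m γ) :
    (m γ) ^ (-p) ≤ A ^ (-p) * (Q ^ (-p)) ^ k := by
  have hAQ : 0 < A * Q ^ k := mul_pos hA (pow_pos hQ k)
  calc (m γ) ^ (-p) ≤ (A * Q ^ k) ^ (-p) := Real.rpow_le_rpow_of_nonpos hAQ hγ (neg_nonpos.2 hp.le)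
    _ = A ^ (-p) * (Q ^ k) ^ (-p) := Real.mul_rpow hA.le (pow_nonneg hQ.le k)
    _ = A ^ (-p) * (Q ^ (-p)) ^ k := by
        rw [← Real.rpow_natCast (Q ^ (-p)) k, ← Real.rpow_mul hQ.le, ← Real.rpow_natCast Q k, ← Real.rpow_mul hQ.le, mul_comm (k : ℝ)]

/-! ## §3 The geometric series: `∫⁻_{A < m} m^{-p} dμ < ∞` when `κ Q^p > 1` -/

include hm hc hκ hQ hmc in
/-- **SHELL BOUND**: `∫⁻_{A Q^k ≤ m ≤ A Q^{k+1}} m^{-p} dμ ≤ A^{-p} (Q^{-p})^k · κ^{-(k+1)} μ(B_A)`. [cite: Casselman1995, §6.4 p. 63] [cite: TateThesis1967, §2.4] -/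
theorem lintegral_shell_le (hκ0 : κ ≠ 0) {A : ℝ} (hA : 0 < A) {p : ℝ} (hp : 0 < p) (k : ℕ) :
    ∫⁻ γ in {γ | A * Q ^ k ≤ m γ ∧ m γ ≤ A * Q ^ (k + 1)}, ENNReal.ofReal ((m γ) ^ (-p)) ∂μ ≤
      ENNReal.ofReal (A ^ (-p) * (Q ^ (-p)) ^ k) * (((κ : ℝ≥0∞)⁻¹) ^ (k + 1) * μ {γ | m γ ≤ A}) := by
  have hS : MeasurableSet {γ | A * Q ^ k ≤ m γ ∧ m γ ≤ A * Q ^ (k + 1)} :=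
    (measurableSet_le measurable_const hm).inter (measurableSet_le hm measurable_const)
  calc ∫⁻ γ in {γ | A * Q ^ k ≤ m γ ∧ m γ ≤ A * Q ^ (k + 1)}, ENNReal.ofReal ((m γ) ^ (-p)) ∂μ
      ≤ ∫⁻ _ in {γ | A * Q ^ k ≤ m γ ∧ m γ ≤ A * Q ^ (k + 1)}, ENNReal.ofReal (A ^ (-p) * (Q ^ (-p)) ^ k) ∂μ :=
        setLIntegral_mono measurable_const fun γ hγ => ENNReal.ofReal_le_ofReal (rpow_neg_le_on_shell hQ hA hp k hγ.1)
    _ = ENNReal.ofReal (A ^ (-p) * (Q ^ (-p)) ^ k) * μ {γ | A * Q ^ k ≤ m γ ∧ m γ ≤ A * Q ^ (k + 1)} := setLIntegral_const _ _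
    _ ≤ ENNReal.ofReal (A ^ (-p) * (Q ^ (-p)) ^ k) * μ {γ | m γ ≤ A * Q ^ (k + 1)} := by
        gcongr
        exact fun h => h.2
    _ = ENNReal.ofReal (A ^ (-p) * (Q ^ (-p)) ^ k) * (((κ : ℝ≥0∞)⁻¹) ^ (k + 1) * μ {γ | m γ ≤ A}) := by
        rw [measure_ball_pow_eq μ hm hc hκ hQ hmc hκ0 A (k + 1)]

include hm hc hκ hQ hmc in
/-- **HEIGHT-SHELL SUMMABILITY.**  If `μ(B_A) < ∞` (`A > 0`), `Q > 1`, `p > 0` and `κ · Q^p > 1`, then `∫⁻_{A < m} m^{-p} dμ < ∞`: cover `{A < m}` by the shells, bound each by §2,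
and sum the geometric series of ratio `Q^{-p} κ⁻¹ < 1` (Mathlib `ENNReal.tsum_geometric`). [cite: Casselman1995, §6.4 p. 63] [cite: TateThesis1967, §2.4] [cite: WeilBNT1967, Ch. II §5 Prop. 12] -/
theorem lintegral_rpow_neg_lt_top_of_scaling (hκ0 : κ ≠ 0) (hQ1 : 1 < Q) {A : ℝ} (hA : 0 < A) (hfin : μ {γ | m γ ≤ A} ≠ ∞)
    {p : ℝ} (hp : 0 < p) (hκQ : 1 < (κ : ℝ) * Q ^ p) :
    ∫⁻ γ in {γ | A < m γ}, ENNReal.ofReal ((m γ) ^ (-p)) ∂μ < ∞ := by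
  -- the ratio of the geometric series
  set r : ℝ≥0∞ := ENNReal.ofReal (Q ^ (-p)) * (κ : ℝ≥0∞)⁻¹ with hr
  have hκpos : (0 : ℝ) < κ := by
    have : (0 : ℝ) ≤ κ := κ.2
    rcases this.eq_or_lt with h | h
    · exfalso
      rw [← h, zero_mul] at hκQ
      exact absurd hκQ (by norm_num)
    · exact h
  have hr1 : r < 1 := by
    have hQp : 0 < Q ^ p := Real.rpow_pos_of_pos hQ p
    have hlt : Q ^ (-p) < (κ : ℝ) := by
      rw [Real.rpow_neg hQ.le, inv_lt_iff_one_lt_mul₀ hQp]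
      exact hκQ
    have h1 : ENNReal.ofReal (Q ^ (-p)) < (κ : ℝ≥0∞) := by
      rw [← ENNReal.ofReal_coe_nnreal]
      exact (ENNReal.ofReal_lt_ofReal_iff hκpos).2 hlt
    rw [hr, ← div_eq_mul_inv, ENNReal.div_lt_iff (Or.inl (ENNReal.coe_ne_zero.2 hκ0)) (Or.inl ENNReal.coe_ne_top), one_mul]
    exact h1
  -- shell by shell
  calc ∫⁻ γ in {γ | A < m γ}, ENNReal.ofReal ((m γ) ^ (-p)) ∂μ
      ≤ ∫⁻ γ in ⋃ k : ℕ, {γ | A * Q ^ k ≤ m γ ∧ m γ ≤ A * Q ^ (k + 1)}, ENNReal.ofReal ((m γ) ^ (-p)) ∂μ :=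
        lintegral_mono_set (setOf_lt_subset_iUnion_shell hA hQ1)
    _ ≤ ∑' k : ℕ, ∫⁻ γ in {γ | A * Q ^ k ≤ m γ ∧ m γ ≤ A * Q ^ (k + 1)}, ENNReal.ofReal ((m γ) ^ (-p)) ∂μ := lintegral_iUnion_le _ _
    _ ≤ ∑' k : ℕ, ENNReal.ofReal (A ^ (-p) * (Q ^ (-p)) ^ k) * (((κ : ℝ≥0∞)⁻¹) ^ (k + 1) * μ {γ | m γ ≤ A}) :=
        ENNReal.tsum_le_tsum fun k => lintegral_shell_le μ hm hc hκ hQ hmc hκ0 hA hp k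
    _ = ∑' k : ℕ, (ENNReal.ofReal (A ^ (-p)) * ((κ : ℝ≥0∞)⁻¹ * μ {γ | m γ ≤ A})) * r ^ k := by
        refine tsum_congr fun k => ?_
        rw [ENNReal.ofReal_mul (Real.rpow_nonneg hA.le _), ENNReal.ofReal_pow (Real.rpow_nonneg hQ.le _), hr, mul_pow, pow_succ]
        ring
    _ = (ENNReal.ofReal (A ^ (-p)) * ((κ : ℝ≥0∞)⁻¹ * μ {γ | m γ ≤ A})) * (1 - r)⁻¹ := by
        rw [ENNReal.tsum_mul_left, ENNReal.tsum_geometric]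
    _ < ∞ := by
        refine ENNReal.mul_lt_top (ENNReal.mul_lt_top ENNReal.ofReal_lt_top
          (ENNReal.mul_lt_top (ENNReal.inv_lt_top.2 (pos_iff_ne_zero.2 (ENNReal.coe_ne_zero.2 hκ0))) hfin.lt_top)) ?_
        exact ENNReal.inv_lt_top.2 (tsub_pos_iff_lt.2 hr1)

include hm hc hκ hQ hmc in
/-- **`IntegrableOn` form**: under the same hypotheses the real function `γ ↦ (m γ)^{-p}` is integrable on `{A < m}` (it is measurable and non-negative there, with finite
lower integral). [cite: Casselman1995, §6.4 p. 63] [cite: TateThesis1967, §2.4] -/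
theorem integrableOn_rpow_neg_of_scaling (hκ0 : κ ≠ 0) (hQ1 : 1 < Q) {A : ℝ} (hA : 0 < A) (hfin : μ {γ | m γ ≤ A} ≠ ∞)
    {p : ℝ} (hp : 0 < p) (hκQ : 1 < (κ : ℝ) * Q ^ p) :
    IntegrableOn (fun γ => (m γ) ^ (-p)) {γ | A < m γ} μ := by
  have hmeas : AEStronglyMeasurable (fun γ => (m γ) ^ (-p)) (μ.restrict {γ | A < m γ}) :=
    (hm.pow_const (-p)).aestronglyMeasurable
  refine ⟨hmeas, ?_⟩
  rw [hasFiniteIntegral_iff_norm]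
  refine lt_of_le_of_lt (lintegral_mono_ae ?_) (lintegral_rpow_neg_lt_top_of_scaling μ hm hc hκ hQ hmc hκ0 hQ1 hA hfin hp hκQ)
  filter_upwards [ae_restrict_mem (measurableSet_lt measurable_const hm)] with γ hγ
  rw [Real.norm_of_nonneg (Real.rpow_nonneg (hA.le.trans (le_of_lt hγ)) _)]

end Summit.HodgeConjecture.HodgeConjecture.Cruxes.H413.K2E3IntertwiningIntegralShellBound

end
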